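import Literature.Geometry.Kaehler.ComplexTorusLefschetzLieAlgebra
import Literature.Geometry.Kaehler.ComplexTorusHodgeLieAlgebraDefinedOverQ
import HarnessLib

/-!
# Milne's `ℚ`-Lie algebra `Lie S(A) = {γ ∈ C(A) | γ† = -γ}` and «`𝔩𝔣` is defined over `ℚ`»:
# `𝔩𝔣 = Lie S(X)(ℝ) = (Lie S(X))(ℚ) ⊗_ℚ ℝ` has a basis of rational matrices, `dim_ℝ 𝔩𝔣 = dim_ℚ Lie S(X)`

Layer `Literature/Geometry/Kaehler`, namespace `Literature.Geometry.Kaehler.ComplexTorus`; lane `lit-hodgefound`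
(Track 2 foundations library), seat p36, generation 17, row g17-#5.  ONE definition with body (`lefschetzLieRat`, the
`ℚ`-points of Milne's Lie algebra of `S(A)`) and theorems; no named fact (D-0026, net debt 0).  Sequel, BY NAME, of

* `ComplexTorusLefschetzLieAlgebra.lean` (g16-#5: the real and complex Lie algebras `lefschetzLie Φ G = 𝔩𝔣 ⊆ M_ι(ℝ)`,
  `lefschetzLieC Φ G = 𝔩𝔣_ℂ`, cut out by `ᵗX G = -G X` and `X A = A X` (`A ∈ End_ℚ(X) = endAlgRat Φ`);
  `mem_lefschetzLie_iff`, `mem_lefschetzLie_iff_map_mem`, `trace_eq_zero_of_mem_lefschetzLie`);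
* p17's `ComplexTorusHodgeLieAlgebraDefinedOverQ.lean` (g16-#3: the RATIONAL LINEAR ALGEBRA ENGINE
  `setOf_forall_sum_ratCast_mul_eq_zero_eq_span` «a family of rational linear equations cuts out a real subspace spanned
  by its rational solutions» and `finrank_span_ratCast_comp_image` «`dim_ℝ (U ⊗ ℝ) = dim_ℚ U`», and the same statement
  for `𝔥𝔤_ℝ`: `coe_hodgeGroupLie_eq_span_rat`, `exists_rat_basis_hodgeGroupLie` — there WITHOUT a `ℚ`-form as an object,
  because the equations of `𝔥𝔤_ℝ` are indexed by the Hodge classes of all powers; for `𝔩𝔣` the equations are the finitely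
  many entries of `ᵗX G + G X` and of `X A - A X`, so the `ℚ`-form is the honest `ℚ`-Lie algebra below);
* `ComplexTorusRosati.lean` (`rosati G A = G⁻¹ ᵗA G`, `rosati_eq_iff`).

## Sources, verbatim

* J. S. Milne, *Lefschetz classes on abelian varieties*, Duke Math. J. 96 (1999) (held text
  `paper:doi-10-1215-s0012-7094-99-09620-5`), §1 p. 643 (p0004): «The `k`-algebra `C(A)`. For an abelian variety `A`
  over `Ω`, we define `C(A)` to be the centralizer of `End⁰(A)` in `End_k(V(A))`: `C(A) = End_{End⁰(A) ⊗_ℚ k}(V(A))`.»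
  and p. 644 (p0006): «The group `S(A)`. For an abelian variety `A` over `Ω`, we define `S(A)` to be the algebraic
  subgroup of `GL(V(A))` such that, for all commutative `k`-algebras `R`, `S(A)(R) = {γ ∈ C(A) ⊗_k R | γ†γ = 1}`. Thus,
  for any ample divisor `D` on `A`, `S(A)` is the largest algebraic subgroup of `Sp(e_D)` whose elements commute with the
  endomorphisms of `A`. […] It is a reductive group (not necessarily connected) over `k`».  With `k = ℚ` (Betti
  cohomology) the Lie algebra of this `ℚ`-group is the `ℚ`-space `{γ ∈ C(A) | γ† + γ = 0}` (derivative of `γ†γ = 1`),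
  and `Lie(S(A)_ℝ) = Lie(S(A)) ⊗_ℚ ℝ`.
* T. A. Springer, *Linear Algebraic Groups* (2nd ed. 1998), §11.1.1 (p0202): «Let `W` be a subspace of `V`. […] `W` is
  defined over `F` if […] `W` has a basis whose elements lie in `V(F)` […] `k ⊗_F W(F) → W` is an isomorphism»;
  §11.1.2 Exercise (a).
* H. Lange, *Abelian Varieties over the Complex Numbers* (2023), §7.2.4 Exercise (4) (the Lefschetz group as the
  centraliser of `End_ℚ(X)` in `Sp_{2g}`, an algebraic group over `ℚ`); §7.3.1, proof of Prop. 7.3.2 («a Lie subalgebra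
  of `𝔰𝔭(V, E)` defined over `ℚ`»).

## What is here (all `theorem`s except the one `def`)

* §1 **`lefschetzLieRat Φ G : LieSubalgebra ℚ (Matrix ι ι ℚ)`** — Milne's `Lie S(X)` over `k = ℚ`:
  `{A | ᵗA G = -G A, A B = B A ∀ B ∈ End_ℚ(X)}`; `mem_lefschetzLieRat_iff`; **`map_ratCast_mem_lefschetzLie_iff`**
  (`A ⊗ 1 ∈ 𝔩𝔣 ↔ A ∈ Lie S(X)`), `map_algebraMap_mem_lefschetzLieC_iff` (`A ⊗ 1 ∈ 𝔩𝔣_ℂ ↔ A ∈ Lie S(X)`),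
  **`mem_lefschetzLieRat_iff_rosati`** (Milne's form: `A ∈ Lie S(X) ↔ A ∈ C(X) ∧ A† = -A`, `G` non-degenerate),
  `trace_eq_zero_of_mem_lefschetzLieRat` (`Lie S(X) ⊆ 𝔰𝔩`).
* §2 **`coe_lefschetzLie_eq_span_rat`**: `𝔩𝔣 = span_ℝ (Lie S(X) ⊗ 1)` — «`𝔩𝔣` IS DEFINED OVER `ℚ`», by p17's engine
  applied to the rational linear system «entries of `ᵗX G + G X` and of `X B - B X`, `B ∈ End_ℚ(X)`»;
  `mem_lefschetzLie_iff_mem_span_rat`; **`exists_rat_basis_lefschetzLie`** (an `ℝ`-basis of `𝔩𝔣` made of rational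
  matrices); **`finrank_lefschetzLieRat_eq_finrank_lefschetzLie`** (`dim_ℚ Lie S(X) = dim_ℝ 𝔩𝔣`).
* §3 the complex form: `mem_lefschetzLieC_iff_mem_span_rat` (`𝔩𝔣_ℂ = span_ℂ (Lie S(X) ⊗ 1)`),
  `IsRiemannForm.jMatrix_mem_span_rat_lefschetzLie` (`J ∈ 𝔩𝔣` is a real combination of elements of `Lie S(X)`) and
  `IsRiemannForm.lefschetzLieRat_ne_bot` (`Lie S(X) ≠ 0` for a polarised abelian variety of positive dimension).

NOT here: `S(X)` itself as a `ℚ`-group scheme (the tree's `lefschetzGroupC` / `lefschetzGroup` are its `ℂ`- and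
`ℝ`-points); reductivity of `Lie S(X)` over `ℚ`; `dim_ℂ 𝔩𝔣_ℂ = dim_ℚ Lie S(X)`.
-/

noncomputable section

attribute [local instance 100] LieRing.ofAssociativeRing

open scoped Matrix
open Set Function Module Matrix

namespace Literature.Geometry.Kaehler

namespace ComplexTorus

/-! ## §1 Milne's `Lie S(X)` over `ℚ` -/

section Rat

variable {ι : Type*} [Fintype ι] [DecidableEq ι] {E : Type*} [NormedAddCommGroup E] [NormedSpace ℂ E]
  (Φ : (ι → ℝ) ≃L[ℝ] E)

/-- **`Lie S(X)` over `ℚ`** (Milne: `S(A)(R) = {γ ∈ C(A) ⊗ R | γ†γ = 1}`, an algebraic group over `k = ℚ`; its Lie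
algebra is `{γ ∈ C(A) | γ† = -γ}`): the rational matrices `A` with `ᵗA G = -G A` (`A ∈ 𝔰𝔭(V, E)`, i.e. `A† = -A`,
`mem_lefschetzLieRat_iff_rosati`) commuting with `End_ℚ(X)` (`A ∈ C(X)`), a Lie subalgebra of `𝔤𝔩_ι(ℚ)` for the
commutator bracket; `𝔩𝔣 = lefschetzLie Φ G` is its realification (`coe_lefschetzLie_eq_span_rat`).
[cite: Milne1999LefschetzClasses, §1 (p. 644, "The group `S(A)`")] [cite: Gordon1997, 2.14 Definition]
[cite: Lange2023AbelianVarietiesComplex, §7.2.4 Exercise (4)] -/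
def lefschetzLieRat (G : Matrix ι ι ℚ) : LieSubalgebra ℚ (Matrix ι ι ℚ) where
  carrier := {A | Aᵀ * G = -(G * A) ∧ ∀ B ∈ endAlgRat Φ, A * B = B * A}
  zero_mem' := ⟨by rw [Matrix.transpose_zero, Matrix.zero_mul, Matrix.mul_zero, neg_zero],
    fun B _ ↦ by rw [Matrix.zero_mul, Matrix.mul_zero]⟩
  add_mem' {X Y} hX hY := ⟨by rw [Matrix.transpose_add, Matrix.add_mul, hX.1, hY.1, Matrix.mul_add, neg_add],
    fun B hB ↦ by rw [Matrix.add_mul, Matrix.mul_add, hX.2 B hB, hY.2 B hB]⟩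
  smul_mem' c {X} hX := ⟨by
      show (c • X)ᵀ * _ = -(_ * (c • X))
      rw [Matrix.transpose_smul, Matrix.smul_mul, hX.1, Matrix.mul_smul, smul_neg],
    fun B hB ↦ by
      show c • X * _ = _ * (c • X)
      rw [Matrix.smul_mul, Matrix.mul_smul, hX.2 B hB]⟩
  lie_mem' {X Y} hX hY := by
    refine ⟨?_, fun B hB ↦ ?_⟩
    · show (X * Y - Y * X)ᵀ * G = -(G * (X * Y - Y * X))
      have h1 : Yᵀ * Xᵀ * G = G * Y * X := by
        rw [Matrix.mul_assoc, hX.1, Matrix.mul_neg, ← Matrix.mul_assoc, hY.1, Matrix.neg_mul, neg_neg]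
      have h2 : Xᵀ * Yᵀ * G = G * X * Y := by
        rw [Matrix.mul_assoc, hY.1, Matrix.mul_neg, ← Matrix.mul_assoc, hX.1, Matrix.neg_mul, neg_neg]
      rw [Matrix.transpose_sub, Matrix.transpose_mul, Matrix.transpose_mul, Matrix.sub_mul, h1, h2,
        Matrix.mul_sub, Matrix.mul_assoc, Matrix.mul_assoc, neg_sub]
    · show (X * Y - Y * X) * B = B * (X * Y - Y * X)
      have h1 : X * Y * B = B * (X * Y) := by
        rw [Matrix.mul_assoc, hY.2 B hB, ← Matrix.mul_assoc, hX.2 B hB, Matrix.mul_assoc]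
      have h2 : Y * X * B = B * (Y * X) := by
        rw [Matrix.mul_assoc, hX.2 B hB, ← Matrix.mul_assoc, hY.2 B hB, Matrix.mul_assoc]
      rw [Matrix.sub_mul, h1, h2, Matrix.mul_sub]

/-- Membership in `Lie S(X)`: `ᵗA G = -G A` and `A B = B A` for all `B ∈ End_ℚ(X)`. [cite: Milne1999LefschetzClasses, §1 (p. 644)] -/
theorem mem_lefschetzLieRat_iff {G : Matrix ι ι ℚ} {A : Matrix ι ι ℚ} :
    A ∈ lefschetzLieRat Φ G ↔ Aᵀ * G = -(G * A) ∧ ∀ B ∈ endAlgRat Φ, A * B = B * A :=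
  Iff.rfl

variable {Φ}

omit [Fintype ι] [DecidableEq ι] in
/-- `A ↦ A ⊗ 1 : M_ι(ℚ) → M_ι(ℝ)` is injective. [folklore] -/
private theorem map_ratCast_injective :
    Function.Injective fun A : Matrix ι ι ℚ ↦ A.map ((↑) : ℚ → ℝ) :=
  fun _ _ h ↦ Matrix.map_injective Rat.cast_injective h

omit [DecidableEq ι] in
/-- `(AB) ⊗ 1 = (A ⊗ 1)(B ⊗ 1)`. [folklore] -/
private theorem map_ratCast_mul₅ (A B : Matrix ι ι ℚ) :
    (A * B).map ((↑) : ℚ → ℝ) = A.map ((↑) : ℚ → ℝ) * B.map ((↑) : ℚ → ℝ) := by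
  rw [show ((↑) : ℚ → ℝ) = (Rat.castHom ℝ : ℚ → ℝ) from rfl, Matrix.map_mul]

omit [Fintype ι] [DecidableEq ι] in
/-- `(-A) ⊗ 1 = -(A ⊗ 1)`. [folklore] -/
private theorem map_ratCast_neg₅ (A : Matrix ι ι ℚ) : (-A).map ((↑) : ℚ → ℝ) = -A.map ((↑) : ℚ → ℝ) := by
  ext i j
  simp [Matrix.map_apply]

omit [Fintype ι] [DecidableEq ι] in
/-- `(P ⊗_ℚ ℝ) ⊗_ℝ ℂ = P ⊗_ℚ ℂ`. [folklore] -/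
private theorem map_ratCast_map_ofRealHom₅ (P : Matrix ι ι ℚ) :
    (P.map ((↑) : ℚ → ℝ)).map Complex.ofRealHom = P.map (algebraMap ℚ ℂ) := by
  ext i j
  simp only [Matrix.map_apply, Complex.ofRealHom_eq_coe, Complex.ofReal_ratCast, eq_ratCast]

/-- **`A ⊗ 1 ∈ 𝔩𝔣 ↔ A ∈ Lie S(X)`**: the rational elements of `𝔩𝔣 = Lie S(X)(ℝ)` are the elements of `Lie S(X)` (the
equations have rational coefficients). [cite: Milne1999LefschetzClasses, §1 (p. 644)] [cite: Springer1998, §11.1.1] -/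
theorem map_ratCast_mem_lefschetzLie_iff {G : Matrix ι ι ℚ} {A : Matrix ι ι ℚ} :
    A.map ((↑) : ℚ → ℝ) ∈ lefschetzLie Φ G ↔ A ∈ lefschetzLieRat Φ G := by
  rw [mem_lefschetzLie_iff, mem_lefschetzLieRat_iff]
  refine and_congr ⟨fun h ↦ map_ratCast_injective ?_, fun h ↦ ?_⟩
    (forall₂_congr fun B _ ↦ ⟨fun h ↦ map_ratCast_injective ?_, fun h ↦ ?_⟩)
  · show (Aᵀ * G).map ((↑) : ℚ → ℝ) = (-(G * A)).map ((↑) : ℚ → ℝ)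
    rw [map_ratCast_mul₅, map_ratCast_neg₅, map_ratCast_mul₅, Matrix.transpose_map]
    exact h
  · rw [← Matrix.transpose_map, ← map_ratCast_mul₅, h, map_ratCast_neg₅, map_ratCast_mul₅]
  · show (A * B).map ((↑) : ℚ → ℝ) = (B * A).map ((↑) : ℚ → ℝ)
    rw [map_ratCast_mul₅, map_ratCast_mul₅]
    exact h
  · rw [← map_ratCast_mul₅, h, map_ratCast_mul₅]

/-- **`A ⊗ 1 ∈ 𝔩𝔣_ℂ ↔ A ∈ Lie S(X)`** (complex points). [cite: Milne1999LefschetzClasses, §1 (p. 644)] -/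
theorem map_algebraMap_mem_lefschetzLieC_iff {G : Matrix ι ι ℚ} {A : Matrix ι ι ℚ} :
    A.map (algebraMap ℚ ℂ) ∈ lefschetzLieC Φ G ↔ A ∈ lefschetzLieRat Φ G := by
  rw [← map_ratCast_mem_lefschetzLie_iff, mem_lefschetzLie_iff_map_mem, map_ratCast_map_ofRealHom₅]

/-- **MILNE'S FORM `Lie S(X) = {γ ∈ C(X) | γ† = -γ}`**: for `G` non-degenerate, `A ∈ Lie S(X)` iff `A` commutes with
`End_ℚ(X)` (`A ∈ C(X)`) and is anti-fixed by the Rosati involution `A† = G⁻¹ ᵗA G` (the derivative at `1` of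
`γ†γ = 1`). [cite: Milne1999LefschetzClasses, §1 (p. 644: "`S(A)(R) = {γ ∈ C(A) ⊗_k R | γ†γ = 1}`")]
[cite: Lange2023AbelianVarietiesComplex, §2.4.1 (Rosati involution)] -/
theorem mem_lefschetzLieRat_iff_rosati {G : Matrix ι ι ℚ} (hG : IsUnit G.det) {A : Matrix ι ι ℚ} :
    A ∈ lefschetzLieRat Φ G ↔ (∀ B ∈ endAlgRat Φ, A * B = B * A) ∧ rosati G A = -A := by
  rw [mem_lefschetzLieRat_iff, rosati_eq_iff hG, Matrix.mul_neg, and_comm]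

/-- `Lie S(X)` commutes with `End_ℚ(X)`: `Lie S(X) ⊆ C(X)`. [cite: Milne1999LefschetzClasses, §1 (p. 643, "The `k`-algebra `C(A)`")] -/
theorem mul_comm_of_mem_lefschetzLieRat {G : Matrix ι ι ℚ} {A : Matrix ι ι ℚ} (hA : A ∈ lefschetzLieRat Φ G)
    {B : Matrix ι ι ℚ} (hB : B ∈ endAlgRat Φ) : A * B = B * A :=
  hA.2 B hB

/-- `Lie S(X) ⊆ 𝔰𝔩`: `tr A = 0` for `A ∈ Lie S(X)` (`G` non-degenerate). [cite: Milne1999LefschetzClasses, §1 (p. 644: "`S(A) ⊂ Sp(e_D)`")] -/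
theorem trace_eq_zero_of_mem_lefschetzLieRat {G : Matrix ι ι ℚ} (hG : G.det ≠ 0) {A : Matrix ι ι ℚ}
    (hA : A ∈ lefschetzLieRat Φ G) : A.trace = 0 := by
  have h := trace_eq_zero_of_mem_lefschetzLie hG (map_ratCast_mem_lefschetzLie_iff.2 hA)
  have htr : (A.map ((↑) : ℚ → ℝ)).trace = ((A.trace : ℚ) : ℝ) := by
    simp [Matrix.trace, Matrix.map_apply]
  rw [htr] at h
  exact_mod_cast h

end Rat

/-! ## §2 `𝔩𝔣` is defined over `ℚ`: `𝔩𝔣 = Lie S(X) ⊗_ℚ ℝ` -/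

section DefinedOverQ

variable {ι : Type*} [Fintype ι] [DecidableEq ι] {E : Type*} [NormedAddCommGroup E] [NormedSpace ℂ E]
  (Φ : (ι → ℝ) ≃L[ℝ] E) (G : Matrix ι ι ℚ)

omit [DecidableEq ι] in
/-- `Σ_{(k,l)} [l = i] g(k) X_{kl} = Σ_k g(k) X_{ki}` (a column of `X` against `g`). [folklore] -/
private theorem sum_ite_snd_mul [DecidableEq ι] (g : ι → ℝ) (X : Matrix ι ι ℝ) (i : ι) :
    ∑ t : ι × ι, (if t.2 = i then g t.1 else 0) * X t.1 t.2 = ∑ k, g k * X k i := by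
  rw [Fintype.sum_prod_type]
  refine Finset.sum_congr rfl fun k _ ↦ ?_
  simp only [ite_mul, zero_mul, Finset.sum_ite_eq', Finset.mem_univ, if_true]

omit [DecidableEq ι] in
/-- `Σ_{(k,l)} [k = i] g(l) X_{kl} = Σ_l g(l) X_{il}` (a row of `X` against `g`). [folklore] -/
private theorem sum_ite_fst_mul [DecidableEq ι] (g : ι → ℝ) (X : Matrix ι ι ℝ) (i : ι) :
    ∑ t : ι × ι, (if t.1 = i then g t.2 else 0) * X t.1 t.2 = ∑ l, g l * X i l := by
  rw [Fintype.sum_prod_type, Finset.sum_comm]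
  refine Finset.sum_congr rfl fun l _ ↦ ?_
  simp only [ite_mul, zero_mul, Finset.sum_ite_eq', Finset.mem_univ, if_true]

/-- **«`𝔩𝔣` IS DEFINED OVER `ℚ`»: `𝔩𝔣 = Lie S(X)(ℝ)` is the real span of `Lie S(X) ⊗ 1`** (every complex torus, every
`G`): `𝔩𝔣` is the common zero set of the RATIONAL linear forms «`(i,j)` entry of `ᵗX G + G X`» and «`(i,j)` entry of
`X B - B X`, `B ∈ End_ℚ(X)`» in the entries of `X`, and such a zero set is spanned by its rational points (p17's
`setOf_forall_sum_ratCast_mul_eq_zero_eq_span`), which are exactly `Lie S(X)` (`map_ratCast_mem_lefschetzLie_iff`).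
[cite: Milne1999LefschetzClasses, §1 (p. 644: `S(A)` "algebraic subgroup of `GL(V(A))`" over `k`)]
[cite: Springer1998, §11.1.1 (a) (p0202)] [cite: Lange2023AbelianVarietiesComplex, §7.3.1, proof of Prop. 7.3.2] -/
theorem coe_lefschetzLie_eq_span_rat :
    (lefschetzLie Φ G : Set (Matrix ι ι ℝ)) =
      ↑(Submodule.span ℝ ((fun A : Matrix ι ι ℚ ↦ A.map ((↑) : ℚ → ℝ)) ''
        (lefschetzLieRat Φ G : Set (Matrix ι ι ℚ)))) := by
  classical
  -- the rational equations, indexed by `α = (ι × ι) ⊕ (End_ℚ(X) × ι × ι)`, in the entries `t = (k, l)` of `X`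
  let α := (ι × ι) ⊕ ((endAlgRat Φ) × (ι × ι))
  let f : α → ι × ι → ℚ := fun a ↦ Sum.elim
    (fun ij t ↦ (if t.2 = ij.1 then G t.1 ij.2 else 0) + (if t.2 = ij.2 then G ij.1 t.1 else 0))
    (fun Bij t ↦ (if t.1 = Bij.2.1 then (Bij.1 : Matrix ι ι ℚ) t.2 Bij.2.2 else 0) -
      (if t.2 = Bij.2.2 then (Bij.1 : Matrix ι ι ℚ) Bij.2.1 t.1 else 0)) a
  -- the two families of real sums are the entries of `ᵗX G + G X` and of `X B - B X`
  have hsym : ∀ (X : Matrix ι ι ℝ) (i j : ι), ∑ t : ι × ι, (f (Sum.inl (i, j)) t : ℝ) * X t.1 t.2 =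
      (Xᵀ * G.map ((↑) : ℚ → ℝ) + G.map ((↑) : ℚ → ℝ) * X) i j := by
    intro X i j
    have hc : ∀ t : ι × ι, (f (Sum.inl (i, j)) t : ℝ) =
        (if t.2 = i then (G t.1 j : ℝ) else 0) + (if t.2 = j then (G i t.1 : ℝ) else 0) := fun t ↦ by
      simp only [f, Sum.elim_inl, Rat.cast_add, apply_ite ((↑) : ℚ → ℝ), Rat.cast_zero]
    simp only [hc, add_mul, Finset.sum_add_distrib]
    rw [sum_ite_snd_mul (fun k ↦ (G k j : ℝ)) X i, sum_ite_snd_mul (fun k ↦ (G i k : ℝ)) X j]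
    simp only [Matrix.add_apply, Matrix.mul_apply, Matrix.transpose_apply, Matrix.map_apply]
    exact congrArg₂ (· + ·) (Finset.sum_congr rfl fun k _ ↦ mul_comm _ _) rfl
  have hcom : ∀ (X : Matrix ι ι ℝ) (B : endAlgRat Φ) (i j : ι),
      ∑ t : ι × ι, (f (Sum.inr (B, (i, j))) t : ℝ) * X t.1 t.2 =
        (X * (B : Matrix ι ι ℚ).map ((↑) : ℚ → ℝ) - (B : Matrix ι ι ℚ).map ((↑) : ℚ → ℝ) * X) i j := by
    intro X B i j
    have hc : ∀ t : ι × ι, (f (Sum.inr (B, (i, j))) t : ℝ) =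
        (if t.1 = i then ((B : Matrix ι ι ℚ) t.2 j : ℝ) else 0) -
          (if t.2 = j then ((B : Matrix ι ι ℚ) i t.1 : ℝ) else 0) := fun t ↦ by
      simp only [f, Sum.elim_inr, Rat.cast_sub, apply_ite ((↑) : ℚ → ℝ), Rat.cast_zero]
    simp only [hc, sub_mul, Finset.sum_sub_distrib]
    rw [sum_ite_fst_mul (fun l ↦ ((B : Matrix ι ι ℚ) l j : ℝ)) X i,
      sum_ite_snd_mul (fun k ↦ ((B : Matrix ι ι ℚ) i k : ℝ)) X j]
    simp only [Matrix.sub_apply, Matrix.mul_apply, Matrix.map_apply]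
    exact congrArg₂ (· - ·) (Finset.sum_congr rfl fun k _ ↦ mul_comm _ _) rfl
  -- `X ∈ 𝔩𝔣` iff its entry vector solves the family `f`
  have hmem : ∀ X : Matrix ι ι ℝ, X ∈ lefschetzLie Φ G ↔ ∀ a : α, ∑ t, (f a t : ℝ) * X t.1 t.2 = 0 := by
    intro X
    rw [mem_lefschetzLie_iff]
    constructor
    · rintro ⟨h1, h2⟩ (⟨i, j⟩ | ⟨B, i, j⟩)
      · rw [hsym, h1, neg_add_cancel, Matrix.zero_apply]
      · rw [hcom, h2 _ B.2, sub_self, Matrix.zero_apply]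
    · intro h
      refine ⟨?_, fun B hB ↦ ?_⟩
      · rw [eq_neg_iff_add_eq_zero]
        ext i j
        rw [← hsym, h (Sum.inl (i, j)), Matrix.zero_apply]
      · rw [← sub_eq_zero]
        ext i j
        rw [← hcom X ⟨B, hB⟩ i j, h (Sum.inr (⟨B, hB⟩, (i, j))), Matrix.zero_apply]
  -- the same for rational matrices
  have hmemQ : ∀ A : Matrix ι ι ℚ, A ∈ lefschetzLieRat Φ G ↔ ∀ a : α, ∑ t, f a t * A t.1 t.2 = 0 := by
    intro A
    rw [← map_ratCast_mem_lefschetzLie_iff, hmem]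
    refine forall_congr' fun a ↦ ?_
    have h : (∑ t, (f a t : ℝ) * (A.map ((↑) : ℚ → ℝ)) t.1 t.2) = ((∑ t, f a t * A t.1 t.2 : ℚ) : ℝ) := by
      rw [Rat.cast_sum]
      exact Finset.sum_congr rfl fun t _ ↦ by rw [Rat.cast_mul, Matrix.map_apply]
    rw [h]
    exact_mod_cast Iff.rfl
  -- the (injective, linear) uncurrying `M_ι(ℝ) → ℝ^{ι × ι}`
  let e : Matrix ι ι ℝ →ₗ[ℝ] (ι × ι → ℝ) :=
    { toFun := fun X t ↦ X t.1 t.2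
      map_add' := fun X Y ↦ rfl
      map_smul' := fun r X ↦ rfl }
  have he : ∀ X : Matrix ι ι ℝ, e X = fun t ↦ X t.1 t.2 := fun _ ↦ rfl
  have he_inj : Function.Injective e := fun X Y h ↦ Matrix.ext fun a b ↦ congr_fun h (a, b)
  have h0 := setOf_forall_sum_ratCast_mul_eq_zero_eq_span f
  -- rational solutions of `f` = entry vectors of the elements of `Lie S(X)`
  have hratsol : {c : ι × ι → ℚ | ∀ a, ∑ t, f a t * c t = 0} =
      (fun A : Matrix ι ι ℚ ↦ fun t ↦ A t.1 t.2) '' (lefschetzLieRat Φ G : Set (Matrix ι ι ℚ)) := by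
    ext c
    simp only [Set.mem_setOf_eq, Set.mem_image, SetLike.mem_coe]
    constructor
    · intro hc
      exact ⟨Matrix.of fun a b ↦ c (a, b), (hmemQ _).2 hc, by funext ⟨a, b⟩; rfl⟩
    · rintro ⟨A, hA, rfl⟩ a
      exact (hmemQ A).1 hA a
  have himage : (fun c : ι × ι → ℚ ↦ ((↑) : ℚ → ℝ) ∘ c) '' {c : ι × ι → ℚ | ∀ a, ∑ t, f a t * c t = 0} =
      e '' ((fun A : Matrix ι ι ℚ ↦ A.map ((↑) : ℚ → ℝ)) '' (lefschetzLieRat Φ G : Set (Matrix ι ι ℚ))) := by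
    rw [hratsol, ← Set.image_comp, ← Set.image_comp]
    rfl
  ext X
  rw [SetLike.mem_coe, SetLike.mem_coe, hmem, ← Submodule.apply_mem_span_image_iff_mem_span he_inj, ← himage,
    ← SetLike.mem_coe, ← h0, Set.mem_setOf_eq, he]

/-- Membership form: `X ∈ 𝔩𝔣` iff `X` is a real linear combination of elements of `Lie S(X) ⊗ 1`.
[cite: Milne1999LefschetzClasses, §1 (p. 644)] [cite: Springer1998, §11.1.1 (a)] -/
theorem mem_lefschetzLie_iff_mem_span_rat {X : Matrix ι ι ℝ} :
    X ∈ lefschetzLie Φ G ↔ X ∈ Submodule.span ℝ ((fun A : Matrix ι ι ℚ ↦ A.map ((↑) : ℚ → ℝ)) ''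
      (lefschetzLieRat Φ G : Set (Matrix ι ι ℚ))) := by
  rw [← SetLike.mem_coe, coe_lefschetzLie_eq_span_rat, SetLike.mem_coe]

/-- The submodule form: `𝔩𝔣 = span_ℝ (Lie S(X) ⊗ 1)` as real subspaces of `M_ι(ℝ)`. [cite: Springer1998, §11.1.1 (a)] -/
theorem toSubmodule_lefschetzLie_eq_span_rat :
    (lefschetzLie Φ G).toSubmodule = Submodule.span ℝ ((fun A : Matrix ι ι ℚ ↦ A.map ((↑) : ℚ → ℝ)) ''
      (lefschetzLieRat Φ G : Set (Matrix ι ι ℚ))) :=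
  SetLike.coe_injective (coe_lefschetzLie_eq_span_rat Φ G)

/-- **`𝔩𝔣` HAS AN `ℝ`-BASIS OF RATIONAL MATRICES** (elements of `Lie S(X)`), linearly independent over `ℝ` and spanning
`𝔩𝔣`. [cite: Springer1998, §11.1.1 (p0202: "`V` has a basis whose elements lie in `V_0`")] [cite: Milne1999LefschetzClasses, §1 (p. 644)] -/
theorem exists_rat_basis_lefschetzLie :
    ∃ (m : ℕ) (A : Fin m → Matrix ι ι ℚ),
      (∀ s, A s ∈ lefschetzLieRat Φ G) ∧
      LinearIndependent ℝ (fun s ↦ (A s).map ((↑) : ℚ → ℝ)) ∧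
      ∀ X : Matrix ι ι ℝ, X ∈ lefschetzLie Φ G ↔
        X ∈ Submodule.span ℝ (Set.range fun s ↦ (A s).map ((↑) : ℚ → ℝ)) := by
  classical
  set S : Set (Matrix ι ι ℝ) := (fun A : Matrix ι ι ℚ ↦ A.map ((↑) : ℚ → ℝ)) ''
    (lefschetzLieRat Φ G : Set (Matrix ι ι ℚ)) with hS
  obtain ⟨b, hbS, hbspan, hbli⟩ := exists_linearIndependent ℝ S
  have hfin : b.Finite := hbli.setFinite
  set m := hfin.toFinset.card with hm
  let eb : Fin m ≃ hfin.toFinset := (hfin.toFinset.equivFin).symm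
  have hebmem : ∀ s : Fin m, ((eb s : hfin.toFinset) : Matrix ι ι ℝ) ∈ b := fun s ↦ by
    have := (eb s).2
    rwa [Set.Finite.mem_toFinset] at this
  have hpre : ∀ s : Fin m, ∃ A : Matrix ι ι ℚ, A ∈ lefschetzLieRat Φ G ∧
      A.map ((↑) : ℚ → ℝ) = (eb s : Matrix ι ι ℝ) := fun s ↦ by
    obtain ⟨A, hA, hAeq⟩ := hbS (hebmem s)
    exact ⟨A, hA, hAeq⟩
  choose A hA hAeq using hpre
  refine ⟨m, A, hA, ?_, fun X ↦ ?_⟩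
  · have hrange : (fun s ↦ (A s).map ((↑) : ℚ → ℝ)) = (fun x : b ↦ (x : Matrix ι ι ℝ)) ∘
        fun s ↦ (⟨(eb s : Matrix ι ι ℝ), hebmem s⟩ : b) := by
      funext s
      exact hAeq s
    rw [hrange]
    refine hbli.comp _ fun s s' h ↦ ?_
    have h' := congrArg (fun x : b ↦ (x : Matrix ι ι ℝ)) h
    exact eb.injective (Subtype.ext h')
  · rw [mem_lefschetzLie_iff_mem_span_rat, ← hS, ← hbspan]
    have hrange : Set.range (fun s ↦ (A s).map ((↑) : ℚ → ℝ)) = b := by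
      ext x
      constructor
      · rintro ⟨s, rfl⟩
        show (A s).map ((↑) : ℚ → ℝ) ∈ b
        rw [hAeq]
        exact hebmem s
      · intro hx
        have hx' : x ∈ hfin.toFinset := by rwa [Set.Finite.mem_toFinset]
        refine ⟨eb.symm ⟨x, hx'⟩, ?_⟩
        show (A (eb.symm ⟨x, hx'⟩)).map ((↑) : ℚ → ℝ) = x
        rw [hAeq, Equiv.apply_symm_apply]
    rw [hrange]

/-- **`dim_ℚ Lie S(X) = dim_ℝ 𝔩𝔣`** (`𝔩𝔣 = Lie S(X) ⊗_ℚ ℝ`): along the uncurrying `M_ι ≅ k^{ι × ι}` this is p17's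
`finrank_span_ratCast_comp_image` «`dim_ℝ (U ⊗ ℝ) = dim_ℚ U`» for `U` = the entry vectors of `Lie S(X)`.
[cite: Springer1998, §11.1.1 (p0202: "`k ⊗_F V_0 → V` is an isomorphism")] [cite: Milne1999LefschetzClasses, §1 (p. 644)] -/
theorem finrank_lefschetzLieRat_eq_finrank_lefschetzLie :
    Module.finrank ℚ (lefschetzLieRat Φ G) = Module.finrank ℝ (lefschetzLie Φ G) := by
  classical
  -- the uncurrying linear equivalences over `ℚ` and over `ℝ`
  let eQ : Matrix ι ι ℚ ≃ₗ[ℚ] (ι × ι → ℚ) :=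
    { toFun := fun A t ↦ A t.1 t.2
      invFun := fun c ↦ Matrix.of fun a b ↦ c (a, b)
      map_add' := fun A B ↦ rfl
      map_smul' := fun r A ↦ rfl
      left_inv := fun A ↦ rfl
      right_inv := fun c ↦ by funext ⟨a, b⟩; rfl }
  let eR : Matrix ι ι ℝ ≃ₗ[ℝ] (ι × ι → ℝ) :=
    { toFun := fun X t ↦ X t.1 t.2
      invFun := fun c ↦ Matrix.of fun a b ↦ c (a, b)
      map_add' := fun X Y ↦ rfl
      map_smul' := fun r X ↦ rfl
      left_inv := fun X ↦ rfl
      right_inv := fun c ↦ by funext ⟨a, b⟩; rfl }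
  -- `U` = entry vectors of `Lie S(X)`
  set U : Submodule ℚ (ι × ι → ℚ) := (lefschetzLieRat Φ G).toSubmodule.map (eQ : Matrix ι ι ℚ →ₗ[ℚ] (ι × ι → ℚ))
    with hU
  have hUfin : Module.finrank ℚ U = Module.finrank ℚ (lefschetzLieRat Φ G) :=
    (LinearEquiv.finrank_eq ((lefschetzLieRat Φ G).toSubmodule.equivMapOfInjective _ eQ.injective)).symm
  -- `eR (𝔩𝔣) = span_ℝ (U ⊗ 1)`
  have himg : (fun v : ι × ι → ℚ ↦ ((↑) : ℚ → ℝ) ∘ v) '' (U : Set (ι × ι → ℚ)) =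
      eR '' ((fun A : Matrix ι ι ℚ ↦ A.map ((↑) : ℚ → ℝ)) '' (lefschetzLieRat Φ G : Set (Matrix ι ι ℚ))) := by
    rw [hU, Submodule.map_coe, ← Set.image_comp, ← Set.image_comp]
    rfl
  have hmap : (lefschetzLie Φ G).toSubmodule.map (eR : Matrix ι ι ℝ →ₗ[ℝ] (ι × ι → ℝ)) =
      Submodule.span ℝ ((fun v : ι × ι → ℚ ↦ ((↑) : ℚ → ℝ) ∘ v) '' (U : Set (ι × ι → ℚ))) := by
    rw [toSubmodule_lefschetzLie_eq_span_rat, Submodule.map_span, himg]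
    rfl
  have hRfin : Module.finrank ℝ (lefschetzLie Φ G) =
      Module.finrank ℝ ((lefschetzLie Φ G).toSubmodule.map (eR : Matrix ι ι ℝ →ₗ[ℝ] (ι × ι → ℝ))) :=
    LinearEquiv.finrank_eq ((lefschetzLie Φ G).toSubmodule.equivMapOfInjective _ eR.injective)
  rw [hRfin, hmap, finrank_span_ratCast_comp_image U, hUfin]

end DefinedOverQ

/-! ## §3 The complex form `𝔩𝔣_ℂ = span_ℂ (Lie S(X) ⊗ 1)` and the element `J` -/

section ComplexForm

variable {ι : Type*} [Fintype ι] [DecidableEq ι] {E : Type*} [NormedAddCommGroup E] [NormedSpace ℂ E]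
  (Φ : (ι → ℝ) ≃L[ℝ] E) (G : Matrix ι ι ℚ)

omit [Fintype ι] [DecidableEq ι] in
/-- `(P ⊗_ℚ ℝ) ⊗_ℝ ℂ = P ⊗_ℚ ℂ` (again, for this section). [folklore] -/
private theorem map_ratCast_map_ofRealHom₅' (P : Matrix ι ι ℚ) :
    (P.map ((↑) : ℚ → ℝ)).map Complex.ofRealHom = P.map (algebraMap ℚ ℂ) := by
  ext i j
  simp only [Matrix.map_apply, Complex.ofRealHom_eq_coe, Complex.ofReal_ratCast, eq_ratCast]

omit [Fintype ι] [DecidableEq ι] in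
/-- Realification of a real span lands in the complex span of the complexified generators. [folklore] -/
private theorem map_ofRealHom_mem_span_of_mem_span {S : Set (Matrix ι ι ℚ)} {X : Matrix ι ι ℝ}
    (hX : X ∈ Submodule.span ℝ ((fun A : Matrix ι ι ℚ ↦ A.map ((↑) : ℚ → ℝ)) '' S)) :
    X.map Complex.ofRealHom ∈ Submodule.span ℂ ((fun A : Matrix ι ι ℚ ↦ A.map (algebraMap ℚ ℂ)) '' S) := by
  induction hX using Submodule.span_induction with
  | mem Y hY =>
    obtain ⟨A, hA, rfl⟩ := hY
    rw [map_ratCast_map_ofRealHom₅']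
    exact Submodule.subset_span ⟨A, hA, rfl⟩
  | zero => rw [Matrix.map_zero _ (map_zero _)]; exact zero_mem _
  | add Y Z _ _ hY hZ => rw [Matrix.map_add _ (map_add _)]; exact add_mem hY hZ
  | smul c Y _ hY =>
    have h : (c • Y).map Complex.ofRealHom = (c : ℂ) • Y.map Complex.ofRealHom := by
      ext i j
      simp [Matrix.map_apply]
    rw [h]
    exact Submodule.smul_mem _ _ hY

/-- **`𝔩𝔣_ℂ = span_ℂ (Lie S(X) ⊗ 1)`**: `Z ∈ 𝔩𝔣_ℂ` iff `Z` is a complex combination of elements of `Lie S(X)`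
(`𝔩𝔣_ℂ = 𝔩𝔣 ⊕ i𝔩𝔣` by g16-#5's `mem_lefschetzLieC_iff_re_im`, and §2). [cite: Milne1999LefschetzClasses, §1 (p. 644)]
[cite: Springer1998, §11.1.1 (a)] -/
theorem mem_lefschetzLieC_iff_mem_span_rat {Z : Matrix ι ι ℂ} :
    Z ∈ lefschetzLieC Φ G ↔ Z ∈ Submodule.span ℂ ((fun A : Matrix ι ι ℚ ↦ A.map (algebraMap ℚ ℂ)) ''
      (lefschetzLieRat Φ G : Set (Matrix ι ι ℚ))) := by
  constructor
  · intro hZ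
    obtain ⟨hre, him⟩ := mem_lefschetzLieC_iff_re_im.1 hZ
    have hZeq : Z = (Z.map Complex.re).map Complex.ofRealHom + Complex.I • (Z.map Complex.im).map Complex.ofRealHom := by
      ext i j
      simp only [Matrix.add_apply, Matrix.map_apply, Matrix.smul_apply, Complex.ofRealHom_eq_coe, smul_eq_mul]
      rw [mul_comm]
      exact (Complex.re_add_im (Z i j)).symm
    rw [hZeq]
    exact add_mem (map_ofRealHom_mem_span_of_mem_span ((mem_lefschetzLie_iff_mem_span_rat Φ G).1 hre))
      (Submodule.smul_mem _ _ (map_ofRealHom_mem_span_of_mem_span ((mem_lefschetzLie_iff_mem_span_rat Φ G).1 him)))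
  · intro hZ
    have hle : Submodule.span ℂ ((fun A : Matrix ι ι ℚ ↦ A.map (algebraMap ℚ ℂ)) ''
        (lefschetzLieRat Φ G : Set (Matrix ι ι ℚ))) ≤ (lefschetzLieC Φ G).toSubmodule := by
      rw [Submodule.span_le]
      rintro _ ⟨A, hA, rfl⟩
      exact map_algebraMap_mem_lefschetzLieC_iff.2 hA
    exact hle hZ

variable {Φ G} in
/-- **`J ∈ 𝔩𝔣` is a real combination of elements of `Lie S(X)`** — for a polarised abelian variety the complex structure
lies in the realification of Milne's `ℚ`-Lie algebra (`J ∈ 𝔥𝔤_ℝ ⊆ 𝔩𝔣` is g16-#5's `IsRiemannForm.jMatrix_mem_lefschetzLie`).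
[cite: Lange2023AbelianVarietiesComplex, §7.3.1, proof of Prop. 7.3.2 ("defined over `ℚ`, containing `J`")] -/
theorem IsRiemannForm.jMatrix_mem_span_rat_lefschetzLie {η : E [⋀^Fin 2]→L[ℝ] ℝ} (hη : IsRiemannForm Φ η)
    (hG : G.map (Rat.cast : ℚ → ℝ) = latticeGram Φ η) :
    jMatrix Φ ∈ Submodule.span ℝ ((fun A : Matrix ι ι ℚ ↦ A.map ((↑) : ℚ → ℝ)) ''
      (lefschetzLieRat Φ G : Set (Matrix ι ι ℚ))) :=
  (mem_lefschetzLie_iff_mem_span_rat Φ G).1 (hη.jMatrix_mem_lefschetzLie hG)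

variable {Φ G} in
/-- **`Lie S(X) ≠ 0` for a polarised abelian variety of positive dimension** (`J ≠ 0` lies in its real span).
[cite: Milne1999LefschetzClasses, §1 (p. 644)] -/
theorem IsRiemannForm.lefschetzLieRat_ne_bot [Nonempty ι] {η : E [⋀^Fin 2]→L[ℝ] ℝ} (hη : IsRiemannForm Φ η)
    (hG : G.map (Rat.cast : ℚ → ℝ) = latticeGram Φ η) : lefschetzLieRat Φ G ≠ ⊥ := by
  intro h
  have hJ := hη.jMatrix_mem_span_rat_lefschetzLie hG
  rw [h] at hJ
  have h0 : Submodule.span ℝ ((fun A : Matrix ι ι ℚ ↦ A.map ((↑) : ℚ → ℝ)) ''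
      ((⊥ : LieSubalgebra ℚ (Matrix ι ι ℚ)) : Set (Matrix ι ι ℚ))) = ⊥ := by
    rw [Submodule.span_eq_bot]
    rintro _ ⟨A, hA, rfl⟩
    rw [SetLike.mem_coe, LieSubalgebra.mem_bot] at hA
    show A.map ((↑) : ℚ → ℝ) = 0
    rw [hA, Matrix.map_zero _ Rat.cast_zero]
  rw [h0, Submodule.mem_bot] at hJ
  have h1 := jMatrix_mul_jMatrix (Φ := Φ)
  rw [hJ, Matrix.mul_zero] at h1
  have h2 := congrArg (fun M : Matrix ι ι ℝ ↦ M (Classical.arbitrary ι) (Classical.arbitrary ι)) h1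
  simp at h2

end ComplexForm

end ComplexTorus

end Literature.Geometry.Kaehler

end
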